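import Literature.MathematicalPhysics.KineticTheory.ZeroWavenumberSpace
import Literature.Probability.Moments.CovarianceFreezing
import HarnessLib

/-!
# Summable clustering of quasi-local observables from `ρ`-mixing of a shift-invariant state

Topic `Literature/MathematicalPhysics/KineticTheory` (companion of `InfiniteChainCovarianceMixingBox`,
whose box form of mixing it complements by the gap form and the summable majorant, and of
`ZeroWavenumberDataOfClustering`). The summable space clustering `Σ_w |Cov_μ(f, g ∘ τ_w)| < ∞`
asked of the local observables of Doyon's zero-wavenumber data is derived here from two inputs on a
shift-invariant probability measure `μ` on the phase space `ChainConfig = ℤ → ℝ × ℝ` of the infinite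
chain:

* **`ρ`-mixing** between past and future half-lines (hypothesis `hmix`, the printed exponential
  `ρ`-mixing of one-dimensional Gibbs states, taken as data):
  `|∫ f g dμ - ∫ f dμ ∫ g dμ| ≤ C e^{-m n} ‖f‖₂ ‖g‖₂` for `f` measurable w.r.t. the sites `≤ a`
  and `g` w.r.t. the sites `≥ a + n`;
* **quasi-locality of `g` in `L²(μ)`**: local approximants `g_n`, depending on the sites of
  `[-n - R', n + R']`, with `‖g - g_n‖₂ ≤ ε_n` and `Σ_n ε_n < ∞` (for the chain: the time-evolved
  current `j₀ ∘ φ_t`, approximated by the partial dynamics, `InfiniteChainFlowLocality`).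

Then for `f` depending on the sites of `[-R, R]`:
`|Cov_μ(f, g ∘ τ_w)| ≤ ‖f‖₂ ε_{n} + C e^{-m(|w| - n - R - R')} ‖f‖₂ (‖g‖₂ + ε_n)` for
`n + R + R' ≤ |w|` (`abs_covariance_comp_chainShift_le_of_mixing_of_le`, `abs_covariance_comp_chainShift_le`), and with `n = n(w) ≈ (|w| - R - R')/2`
the right-hand side is a summable function of `w ∈ ℤ` which only depends on
`C, m, R, R', ε, ‖f‖₂, ‖g‖₂` (`exists_summable_clustering_majorant`): the uniformity needed to sum, and to
exchange limits in time with the sum over `w`. Everything is proved; tagged `[folklore]`.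
No definitions, no named facts.
-/

noncomputable section

open MeasureTheory ProbabilityTheory Filter Set Function
open scoped Topology

namespace Literature.MathematicalPhysics.KineticTheory.HeatConduction

/-! ### §1 Summability bookkeeping on `ℕ` and `ℤ` -/

/-- Partial sums of `k ↦ φ(⌊k/2⌋)` over `k < 2N`. [folklore] -/
theorem sum_range_two_mul_div_two (φ : ℕ → ℝ) (N : ℕ) :
    ∑ k ∈ Finset.range (2 * N), φ (k / 2) = 2 * ∑ n ∈ Finset.range N, φ n := by
  induction N with
  | zero => simp
  | succ N ih =>
    rw [show 2 * (N + 1) = 2 * N + 1 + 1 by ring, Finset.sum_range_succ, Finset.sum_range_succ, ih,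
      Finset.sum_range_succ]
    have h1 : (2 * N) / 2 = N := by omega
    have h2 : (2 * N + 1) / 2 = N := by omega
    rw [h1, h2]
    ring

/-- If `φ ≥ 0` is summable then so is `k ↦ φ(⌊k/2⌋)`. [folklore] -/
theorem summable_comp_div_two {φ : ℕ → ℝ} (h0 : ∀ n, 0 ≤ φ n) (hφ : Summable φ) :
    Summable fun k : ℕ => φ (k / 2) := by
  refine summable_of_sum_range_le (c := 2 * ∑' n, φ n) (fun k => h0 _) fun N => ?_
  calc ∑ k ∈ Finset.range N, φ (k / 2) ≤ ∑ k ∈ Finset.range (2 * N), φ (k / 2) :=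
        Finset.sum_le_sum_of_subset_of_nonneg (Finset.range_mono (by omega)) fun k _ _ => h0 _
    _ = 2 * ∑ n ∈ Finset.range N, φ n := sum_range_two_mul_div_two φ N
    _ ≤ 2 * ∑' n, φ n := by
        have := hφ.sum_le_tsum (Finset.range N) fun n _ => h0 n
        linarith

/-- If `φ ≥ 0` is summable then so is `k ↦ φ(⌊(k - c)/2⌋)` (truncated subtraction). [folklore] -/
theorem summable_comp_sub_div_two {φ : ℕ → ℝ} (h0 : ∀ n, 0 ≤ φ n) (hφ : Summable φ) (c : ℕ) :
    Summable fun k : ℕ => φ ((k - c) / 2) := by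
  rw [← summable_nat_add_iff c]
  have e : (fun k : ℕ => φ ((k + c - c) / 2)) = fun k => φ (k / 2) := by
    funext k; rw [Nat.add_sub_cancel]
  rw [e]
  exact summable_comp_div_two h0 hφ

/-- A function of `|w|` is summable over `ℤ` as soon as it is summable over `ℕ`. [folklore] -/
theorem summable_int_comp_natAbs {Φ : ℕ → ℝ} (hΦ : Summable Φ) :
    Summable fun w : ℤ => Φ w.natAbs := by
  refine Summable.of_nat_of_neg_add_one ?_ ?_
  · simpa only [Int.natAbs_natCast] using hΦ
  · have e : (fun n : ℕ => Φ (-((n : ℤ) + 1)).natAbs) = fun n => Φ (n + 1) := by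
      funext n
      have : (-((n : ℤ) + 1)).natAbs = n + 1 := by omega
      rw [this]
    rw [e]
    exact (summable_nat_add_iff 1).2 hΦ

/-! ### §2 Locality under lattice translations -/

/-- Translating a local observable translates its dependence set:
`g ∘ τ_w` depends on the sites of `[a + w, b + w]` if `g` depends on those of `[a, b]`. [folklore] -/
theorem dependsOn_comp_chainShift_Icc {α : Type*} {g : ChainConfig → α} {a b : ℤ}
    (hg : DependsOn g (Icc a b)) (w : ℤ) : DependsOn (g ∘ chainShift w) (Icc (a + w) (b + w)) := by
  intro σ σ' h
  simp only [comp_apply]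
  refine hg fun i hi => ?_
  simp only [chainShift_apply]
  exact h (i + w) ⟨by linarith [hi.1], by linarith [hi.2]⟩

/-! ### §3 Second-moment bounds -/

section Moments

variable {μ : Measure ChainConfig}

/-- **Cauchy–Schwarz for the covariance with uncentred second moments**:
`|Cov_μ(X, Y)| ≤ (∫ X²)^{1/2} (∫ Y²)^{1/2}`. [folklore] -/
theorem abs_covariance_le_sqrt_mul_sqrt [IsProbabilityMeasure μ] {X Y : ChainConfig → ℝ}
    (hX : MemLp X 2 μ) (hY : MemLp Y 2 μ) :
    |cov[X, Y; μ]| ≤ Real.sqrt (∫ ω, X ω ^ 2 ∂μ) * Real.sqrt (∫ ω, Y ω ^ 2 ∂μ) := by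
  have h1 := Literature.Probability.Moments.covariance_sq_le_variance_mul hX hY
  have hVX : Var[X; μ] ≤ ∫ ω, X ω ^ 2 ∂μ := by
    have h := variance_le_expectation_sq (μ := μ) hX.aestronglyMeasurable
    simpa only [Pi.pow_apply] using h
  have hVY : Var[Y; μ] ≤ ∫ ω, Y ω ^ 2 ∂μ := by
    have h := variance_le_expectation_sq (μ := μ) hY.aestronglyMeasurable
    simpa only [Pi.pow_apply] using h
  have h0X : 0 ≤ Var[X; μ] := variance_nonneg _ _
  have h0Y : 0 ≤ Var[Y; μ] := variance_nonneg _ _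
  rw [← Real.sqrt_mul (h0X.trans hVX), ← Real.sqrt_sq_eq_abs]
  exact Real.sqrt_le_sqrt (h1.trans (mul_le_mul hVX hVY h0Y (h0X.trans hVX)))

/-- Second moments are invariant under a measure-preserving map. [folklore] -/
theorem integral_sq_comp_eq {S : ChainConfig → ChainConfig} (hS : MeasurePreserving S μ μ)
    {g : ChainConfig → ℝ} (hg : AEStronglyMeasurable g μ) :
    ∫ ω, (g ∘ S) ω ^ 2 ∂μ = ∫ ω, g ω ^ 2 ∂μ := by
  have hg' : AEStronglyMeasurable (fun ω => g ω ^ 2) (μ.map S) := by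
    rw [hS.map_eq]
    exact hg.aemeasurable.pow_const 2 |>.aestronglyMeasurable
  have h := integral_map hS.measurable.aemeasurable hg'
  rw [hS.map_eq] at h
  exact h.symm

/-- `MemLp` is invariant under a measure-preserving map (composition form). [folklore] -/
theorem memLp_comp_of_measurePreserving {S : ChainConfig → ChainConfig} (hS : MeasurePreserving S μ μ)
    {g : ChainConfig → ℝ} (hg : MemLp g 2 μ) : MemLp (g ∘ S) 2 μ :=
  hg.comp_measurePreserving hS

end Moments

/-! ### §4 One covariance: mixing plus approximation -/

section OneCovariance

variable {μ : Measure ChainConfig} [IsProbabilityMeasure μ]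

/-- **Mixing bound for a local pair.** If `f` depends on the sites of `[-R, R]`, `h` on those of
`[-n - R', n + R']`, and `n + R + R' ≤ |w|`, then the `ρ`-mixing hypothesis (applied to the pair
`(f, h ∘ τ_w)` if `w > 0`, to `(h ∘ τ_w, f)` if `w < 0`) gives
`|Cov_μ(f, h ∘ τ_w)| ≤ C e^{-m(|w| - n - R - R')} ‖f‖₂ ‖h‖₂`. [folklore] -/
theorem abs_covariance_comp_chainShift_le_of_mixing_of_le
    (hS : ∀ x : ℤ, MeasurePreserving (chainShift x) μ μ) {C m : ℝ}
    (hmix : ∀ (a : ℤ) (n : ℕ) (f g : ChainConfig → ℝ),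
      DependsOn f {i : ℤ | i ≤ a} → DependsOn g {i : ℤ | a + n ≤ i} → Measurable f → Measurable g →
      MemLp f 2 μ → MemLp g 2 μ →
      |∫ σ, f σ * g σ ∂μ - (∫ σ, f σ ∂μ) * ∫ σ, g σ ∂μ| ≤
        C * Real.exp (-(m * n)) * (∫ σ, f σ ^ 2 ∂μ) ^ (1 / 2 : ℝ) * (∫ σ, g σ ^ 2 ∂μ) ^ (1 / 2 : ℝ))
    {R R' n : ℕ} {f h : ChainConfig → ℝ} (hf : DependsOn f (Icc (-(R : ℤ)) R)) (hfm : Measurable f)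
    (hf2 : MemLp f 2 μ) (hh : DependsOn h (Icc (-(n : ℤ) - R') (n + R'))) (hhm : Measurable h)
    (hh2 : MemLp h 2 μ) {w : ℤ} (hw : (n : ℤ) + R + R' ≤ |w|) :
    |cov[f, h ∘ chainShift w; μ]| ≤
      C * Real.exp (-(m * ((w.natAbs - n - R - R' : ℕ) : ℝ))) * Real.sqrt (∫ σ, f σ ^ 2 ∂μ) *
        Real.sqrt (∫ σ, h σ ^ 2 ∂μ) := by
  have hhw2 : MemLp (h ∘ chainShift w) 2 μ := hh2.comp_measurePreserving (hS w)
  have hhwm : Measurable (h ∘ chainShift w) := hhm.comp (chainShift.measurable w)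
  have hhw : DependsOn (h ∘ chainShift w) (Icc (-(n : ℤ) - R' + w) (n + R' + w)) :=
    dependsOn_comp_chainShift_Icc hh w
  have hcov : cov[f, h ∘ chainShift w; μ] =
      ∫ σ, f σ * (h ∘ chainShift w) σ ∂μ - (∫ σ, f σ ∂μ) * ∫ σ, (h ∘ chainShift w) σ ∂μ := by
    rw [covariance_eq_sub hf2 hhw2]; rfl
  have hsq : ∫ σ, (h ∘ chainShift w) σ ^ 2 ∂μ = ∫ σ, h σ ^ 2 ∂μ :=
    integral_sq_comp_eq (hS w) hh2.aestronglyMeasurable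
  have hgap : ((w.natAbs - n - R - R' : ℕ) : ℤ) = |w| - n - R - R' := by
    have h1 : (n : ℤ) + R + R' ≤ (w.natAbs : ℤ) := by rwa [Int.natCast_natAbs]
    have h2 : n + R + R' ≤ w.natAbs := by exact_mod_cast h1
    rw [← Int.natCast_natAbs]
    omega
  rw [hcov, ← hsq, Real.sqrt_eq_rpow, Real.sqrt_eq_rpow]
  rcases le_or_gt 0 w with hw0 | hw0
  · -- `f` on the left half-line `≤ R`, `h ∘ τ_w` on the right half-line `≥ R + gap`
    have habs : |w| = w := abs_of_nonneg hw0
    refine hmix R (w.natAbs - n - R - R') f (h ∘ chainShift w) (hf.mono fun i hi => hi.2)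
      (hhw.mono fun i hi => ?_) hfm hhwm hf2 hhw2
    simp only [mem_setOf_eq]
    rw [hgap, habs]
    linarith [hi.1]
  · -- `h ∘ τ_w` on the left half-line `≤ w + n + R'`, `f` on the right
    have habs : |w| = -w := abs_of_neg hw0
    have key := hmix (w + n + R') (w.natAbs - n - R - R') (h ∘ chainShift w) f
      (hhw.mono fun i hi => ?_) (hf.mono fun i hi => ?_) hhwm hfm hhw2 hf2
    · have e1 : ∫ σ, (h ∘ chainShift w) σ * f σ ∂μ = ∫ σ, f σ * (h ∘ chainShift w) σ ∂μ :=
        integral_congr_ae (Eventually.of_forall fun σ => mul_comm _ _)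
      rw [e1, mul_comm (∫ σ, (h ∘ chainShift w) σ ∂μ)] at key
      calc |∫ σ, f σ * (h ∘ chainShift w) σ ∂μ - (∫ σ, f σ ∂μ) * ∫ σ, (h ∘ chainShift w) σ ∂μ|
          ≤ C * Real.exp (-(m * ((w.natAbs - n - R - R' : ℕ) : ℝ))) *
              (∫ σ, (h ∘ chainShift w) σ ^ 2 ∂μ) ^ (1 / 2 : ℝ) * (∫ σ, f σ ^ 2 ∂μ) ^ (1 / 2 : ℝ) := key
        _ = C * Real.exp (-(m * ((w.natAbs - n - R - R' : ℕ) : ℝ))) * (∫ σ, f σ ^ 2 ∂μ) ^ (1 / 2 : ℝ) *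
              (∫ σ, (h ∘ chainShift w) σ ^ 2 ∂μ) ^ (1 / 2 : ℝ) := by ring
    · simp only [mem_setOf_eq]
      linarith [hi.2]
    · simp only [mem_setOf_eq]
      rw [hgap, habs]
      linarith [hi.1]

/-- **Mixing plus approximation.** With `f`, `h = g_n` as above and any square-integrable `g`
with `‖g - g_n‖₂ ≤ ε`:
`|Cov_μ(f, g ∘ τ_w)| ≤ ‖f‖₂ ε + C e^{-m(|w| - n - R - R')} ‖f‖₂ (‖g‖₂ + ε)`. [folklore] -/
theorem abs_covariance_comp_chainShift_le
    (hS : ∀ x : ℤ, MeasurePreserving (chainShift x) μ μ) {C m : ℝ} (hC : 0 ≤ C)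
    (hmix : ∀ (a : ℤ) (n : ℕ) (f g : ChainConfig → ℝ),
      DependsOn f {i : ℤ | i ≤ a} → DependsOn g {i : ℤ | a + n ≤ i} → Measurable f → Measurable g →
      MemLp f 2 μ → MemLp g 2 μ →
      |∫ σ, f σ * g σ ∂μ - (∫ σ, f σ ∂μ) * ∫ σ, g σ ∂μ| ≤
        C * Real.exp (-(m * n)) * (∫ σ, f σ ^ 2 ∂μ) ^ (1 / 2 : ℝ) * (∫ σ, g σ ^ 2 ∂μ) ^ (1 / 2 : ℝ))
    {R R' n : ℕ} {f h g : ChainConfig → ℝ} (hf : DependsOn f (Icc (-(R : ℤ)) R)) (hfm : Measurable f)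
    (hf2 : MemLp f 2 μ) (hh : DependsOn h (Icc (-(n : ℤ) - R') (n + R'))) (hhm : Measurable h)
    (hh2 : MemLp h 2 μ) (hg2 : MemLp g 2 μ) {ε : ℝ}
    (hε : Real.sqrt (∫ σ, (g σ - h σ) ^ 2 ∂μ) ≤ ε) {w : ℤ} (hw : (n : ℤ) + R + R' ≤ |w|) :
    |cov[f, g ∘ chainShift w; μ]| ≤
      Real.sqrt (∫ σ, f σ ^ 2 ∂μ) * ε +
        C * Real.exp (-(m * ((w.natAbs - n - R - R' : ℕ) : ℝ))) * Real.sqrt (∫ σ, f σ ^ 2 ∂μ) *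
          (Real.sqrt (∫ σ, g σ ^ 2 ∂μ) + ε) := by
  have hgw2 : MemLp (g ∘ chainShift w) 2 μ := hg2.comp_measurePreserving (hS w)
  have hhw2 : MemLp (h ∘ chainShift w) 2 μ := hh2.comp_measurePreserving (hS w)
  have hε0 : 0 ≤ ε := (Real.sqrt_nonneg _).trans hε
  -- split `g ∘ τ_w = (g - h) ∘ τ_w + h ∘ τ_w`
  have hsplit : cov[f, g ∘ chainShift w; μ] =
      cov[f, (g - h) ∘ chainShift w; μ] + cov[f, h ∘ chainShift w; μ] := by
    have e : g ∘ chainShift w = (g - h) ∘ chainShift w + h ∘ chainShift w := by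
      funext σ; simp
    have hd2 : MemLp ((g - h) ∘ chainShift w) 2 μ := (hg2.sub hh2).comp_measurePreserving (hS w)
    rw [e, covariance_add_right hf2 hd2 hhw2]
  -- the approximation term
  have h1 : |cov[f, (g - h) ∘ chainShift w; μ]| ≤ Real.sqrt (∫ σ, f σ ^ 2 ∂μ) * ε := by
    have hd2 : MemLp ((g - h) ∘ chainShift w) 2 μ := (hg2.sub hh2).comp_measurePreserving (hS w)
    refine (abs_covariance_le_sqrt_mul_sqrt hf2 hd2).trans ?_
    refine mul_le_mul_of_nonneg_left ?_ (Real.sqrt_nonneg _)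
    have e : ∫ σ, ((g - h) ∘ chainShift w) σ ^ 2 ∂μ = ∫ σ, (g σ - h σ) ^ 2 ∂μ :=
      integral_sq_comp_eq (hS w) (hg2.sub hh2).aestronglyMeasurable
    rw [e]
    exact hε
  -- the mixing term
  have h2 := abs_covariance_comp_chainShift_le_of_mixing_of_le hS hmix hf hfm hf2 hh hhm hh2 hw
  have hh_le : Real.sqrt (∫ σ, h σ ^ 2 ∂μ) ≤ Real.sqrt (∫ σ, g σ ^ 2 ∂μ) + ε := by
    -- `‖h‖₂ ≤ ‖g‖₂ + ‖g - h‖₂` (Minkowski in `L²(μ)`)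
    have hL2 : eLpNorm h 2 μ ≤ eLpNorm g 2 μ + eLpNorm (g - h) 2 μ := by
      have e : h = g - (g - h) := by funext σ; simp
      calc eLpNorm h 2 μ = eLpNorm (g - (g - h)) 2 μ := by rw [← e]
        _ ≤ eLpNorm g 2 μ + eLpNorm (g - h) 2 μ :=
            eLpNorm_sub_le hg2.aestronglyMeasurable (hg2.sub hh2).aestronglyMeasurable one_le_two
    have hconv : ∀ {u : ChainConfig → ℝ}, MemLp u 2 μ →
        Real.sqrt (∫ σ, u σ ^ 2 ∂μ) = (eLpNorm u 2 μ).toReal := by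
      intro u hu
      have h := hu.eLpNorm_eq_integral_rpow_norm (by norm_num) ENNReal.ofNat_ne_top
      rw [h, ENNReal.toReal_ofReal (by positivity), Real.sqrt_eq_rpow]
      congr 1
      · refine integral_congr_ae (Eventually.of_forall fun σ => ?_)
        simp only [ENNReal.toReal_ofNat, Real.norm_eq_abs, Real.rpow_two, sq_abs]
      · norm_num
    rw [hconv hh2, hconv hg2]
    have hgh := hconv (hg2.sub hh2)
    have e2 : ∫ σ, (g - h) σ ^ 2 ∂μ = ∫ σ, (g σ - h σ) ^ 2 ∂μ := by rfl
    rw [e2] at hgh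
    rw [hgh] at hε
    have hfin1 : eLpNorm g 2 μ ≠ ⊤ := hg2.eLpNorm_ne_top
    have hfin2 : eLpNorm (g - h) 2 μ ≠ ⊤ := (hg2.sub hh2).eLpNorm_ne_top
    calc (eLpNorm h 2 μ).toReal ≤ (eLpNorm g 2 μ + eLpNorm (g - h) 2 μ).toReal :=
          ENNReal.toReal_mono (ENNReal.add_ne_top.2 ⟨hfin1, hfin2⟩) hL2
      _ = (eLpNorm g 2 μ).toReal + (eLpNorm (g - h) 2 μ).toReal := ENNReal.toReal_add hfin1 hfin2
      _ ≤ (eLpNorm g 2 μ).toReal + ε := by linarith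
  have h3 : |cov[f, h ∘ chainShift w; μ]| ≤
      C * Real.exp (-(m * ((w.natAbs - n - R - R' : ℕ) : ℝ))) * Real.sqrt (∫ σ, f σ ^ 2 ∂μ) *
        (Real.sqrt (∫ σ, g σ ^ 2 ∂μ) + ε) := by
    refine h2.trans (mul_le_mul_of_nonneg_left hh_le ?_)
    have : 0 ≤ Real.exp (-(m * ((w.natAbs - n - R - R' : ℕ) : ℝ))) := Real.exp_nonneg _
    positivity
  rw [hsplit]
  exact (abs_add_le _ _).trans (add_le_add h1 h3)

end OneCovariance

/-! ### §5 The summable majorant -/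

section Majorant

variable {μ : Measure ChainConfig} [IsProbabilityMeasure μ]

/-- **Summable clustering from mixing and quasi-locality, with a uniform majorant.** Fix the
mixing constants `C ≥ 0`, `m > 0`, radii `R, R'`, a summable sequence `ε ≥ 0` and bounds `Mf, Mg`.
There is a summable `F : ℤ → ℝ` such that for EVERY `f` depending on the sites of `[-R, R]` with
`‖f‖₂ ≤ Mf`, every square-integrable `g` with `‖g‖₂ ≤ Mg` and every family of local approximants
`g_n` (depending on the sites of `[-n - R', n + R']`, `‖g - g_n‖₂ ≤ ε_n`):
`|Cov_μ(f, g ∘ τ_w)| ≤ F(w)` for all `w ∈ ℤ`. In particular `w ↦ Cov_μ(f, g ∘ τ_w)` is summable,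
and the bound is uniform over families `(g^t)_t` with common `ε`, `Mg` (e.g. `g^t = j₀ ∘ φ_t`,
`|t| ≤ τ`). [folklore] -/
theorem exists_summable_clustering_majorant
    (hS : ∀ x : ℤ, MeasurePreserving (chainShift x) μ μ) {C m : ℝ} (hC : 0 ≤ C) (hm : 0 < m)
    (hmix : ∀ (a : ℤ) (n : ℕ) (f g : ChainConfig → ℝ),
      DependsOn f {i : ℤ | i ≤ a} → DependsOn g {i : ℤ | a + n ≤ i} → Measurable f → Measurable g →
      MemLp f 2 μ → MemLp g 2 μ →
      |∫ σ, f σ * g σ ∂μ - (∫ σ, f σ ∂μ) * ∫ σ, g σ ∂μ| ≤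
        C * Real.exp (-(m * n)) * (∫ σ, f σ ^ 2 ∂μ) ^ (1 / 2 : ℝ) * (∫ σ, g σ ^ 2 ∂μ) ^ (1 / 2 : ℝ))
    (R R' : ℕ) {ε : ℕ → ℝ} (hε0 : ∀ n, 0 ≤ ε n) (hε : Summable ε) {Mf Mg : ℝ} (hMf : 0 ≤ Mf)
    (hMg : 0 ≤ Mg) :
    ∃ F : ℤ → ℝ, Summable F ∧ ∀ (f g : ChainConfig → ℝ) (gloc : ℕ → ChainConfig → ℝ),
      DependsOn f (Icc (-(R : ℤ)) R) → Measurable f → MemLp f 2 μ →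
      Real.sqrt (∫ σ, f σ ^ 2 ∂μ) ≤ Mf → MemLp g 2 μ → Real.sqrt (∫ σ, g σ ^ 2 ∂μ) ≤ Mg →
      (∀ n, DependsOn (gloc n) (Icc (-(n : ℤ) - R') (n + R'))) → (∀ n, Measurable (gloc n)) →
      (∀ n, MemLp (gloc n) 2 μ) → (∀ n, Real.sqrt (∫ σ, (g σ - gloc n σ) ^ 2 ∂μ) ≤ ε n) →
      ∀ w : ℤ, |cov[f, g ∘ chainShift w; μ]| ≤ F w := by
  -- the index `n(w) = ⌊(|w| - R - R')/2⌋` and the majorant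
  set nw : ℤ → ℕ := fun w => (w.natAbs - (R + R')) / 2 with hnw
  set Φ : ℕ → ℝ := fun k => Mf * ε ((k - (R + R')) / 2) +
    C * Real.exp (-(m * (((k - (R + R')) / 2 : ℕ) : ℝ))) * Mf * (Mg + ε ((k - (R + R')) / 2)) +
      (if k < R + R' then Mf * Mg else 0) with hΦ
  refine ⟨fun w => Φ w.natAbs, summable_int_comp_natAbs ?_, ?_⟩
  · -- summability of `Φ`
    have h1 : Summable fun k : ℕ => Mf * ε ((k - (R + R')) / 2) :=
      (summable_comp_sub_div_two hε0 hε (R + R')).mul_left Mf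
    have hexp : Summable fun j : ℕ => Real.exp (-(m * (j : ℝ))) := by
      have e : (fun j : ℕ => Real.exp (-(m * (j : ℝ)))) = fun j : ℕ => Real.exp (-m) ^ j := by
        funext j; rw [← Real.exp_nat_mul]; ring_nf
      rw [e]
      exact summable_geometric_of_lt_one (Real.exp_nonneg _) (Real.exp_lt_one_iff.2 (by linarith))
    have h2a : Summable fun k : ℕ => Real.exp (-(m * (((k - (R + R')) / 2 : ℕ) : ℝ))) :=
      summable_comp_sub_div_two (φ := fun j : ℕ => Real.exp (-(m * (j : ℝ))))
        (fun j => Real.exp_nonneg _) hexp (R + R')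
    have h2b : Summable fun k : ℕ =>
        Real.exp (-(m * (((k - (R + R')) / 2 : ℕ) : ℝ))) * ε ((k - (R + R')) / 2) := by
      refine Summable.of_nonneg_of_le (fun k => mul_nonneg (Real.exp_nonneg _) (hε0 _)) (fun k => ?_)
        ((summable_comp_sub_div_two hε0 hε (R + R')))
      have : Real.exp (-(m * (((k - (R + R')) / 2 : ℕ) : ℝ))) ≤ 1 :=
        Real.exp_le_one_iff.2 (by have : (0:ℝ) ≤ ((k - (R + R')) / 2 : ℕ) := Nat.cast_nonneg _; nlinarith)
      calc Real.exp (-(m * (((k - (R + R')) / 2 : ℕ) : ℝ))) * ε ((k - (R + R')) / 2)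
          ≤ 1 * ε ((k - (R + R')) / 2) := mul_le_mul_of_nonneg_right this (hε0 _)
        _ = ε ((k - (R + R')) / 2) := one_mul _
    have h2 : Summable fun k : ℕ =>
        C * Real.exp (-(m * (((k - (R + R')) / 2 : ℕ) : ℝ))) * Mf * (Mg + ε ((k - (R + R')) / 2)) := by
      have e : (fun k : ℕ => C * Real.exp (-(m * (((k - (R + R')) / 2 : ℕ) : ℝ))) * Mf *
          (Mg + ε ((k - (R + R')) / 2))) = fun k : ℕ =>
          (C * Mf * Mg) * Real.exp (-(m * (((k - (R + R')) / 2 : ℕ) : ℝ))) +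
            (C * Mf) * (Real.exp (-(m * (((k - (R + R')) / 2 : ℕ) : ℝ))) * ε ((k - (R + R')) / 2)) := by
        funext k; ring
      rw [e]
      exact (h2a.mul_left _).add (h2b.mul_left _)
    have h3 : Summable fun k : ℕ => (if k < R + R' then Mf * Mg else (0 : ℝ)) := by
      refine summable_of_ne_finset_zero (s := Finset.range (R + R')) fun k hk => ?_
      rw [Finset.mem_range] at hk
      exact if_neg hk
    exact (h1.add h2).add h3
  · -- the bound
    intro f g gloc hf hfm hf2 hfM hg2 hgM hdep hglm hgl2 happ w
    have hf0 : 0 ≤ Real.sqrt (∫ σ, f σ ^ 2 ∂μ) := Real.sqrt_nonneg _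
    have hg0 : 0 ≤ Real.sqrt (∫ σ, g σ ^ 2 ∂μ) := Real.sqrt_nonneg _
    show |cov[f, g ∘ chainShift w; μ]| ≤ Φ w.natAbs
    by_cases hsmall : w.natAbs < R + R'
    · -- trivial bound `‖f‖₂ ‖g‖₂`
      have htriv : |cov[f, g ∘ chainShift w; μ]| ≤ Mf * Mg := by
        have hgw2 : MemLp (g ∘ chainShift w) 2 μ := hg2.comp_measurePreserving (hS w)
        refine (abs_covariance_le_sqrt_mul_sqrt hf2 hgw2).trans ?_
        rw [integral_sq_comp_eq (hS w) hg2.aestronglyMeasurable]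
        exact mul_le_mul hfM hgM hg0 hMf
      have hrest : 0 ≤ Mf * ε ((w.natAbs - (R + R')) / 2) +
          C * Real.exp (-(m * (((w.natAbs - (R + R')) / 2 : ℕ) : ℝ))) * Mf *
            (Mg + ε ((w.natAbs - (R + R')) / 2)) := by
        have := hε0 ((w.natAbs - (R + R')) / 2)
        positivity
      rw [hΦ]
      dsimp only
      rw [if_pos hsmall]
      linarith
    · have hle : R + R' ≤ w.natAbs := not_lt.1 hsmall
      set n : ℕ := (w.natAbs - (R + R')) / 2 with hn
      have hnle : n + R + R' ≤ w.natAbs := by omega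
      have hw : (n : ℤ) + R + R' ≤ |w| := by
        rw [← Int.natCast_natAbs]; exact_mod_cast hnle
      have key := abs_covariance_comp_chainShift_le hS hC hmix hf hfm hf2 (hdep n) (hglm n) (hgl2 n)
        hg2 (happ n) hw
      -- the gap is at least `n`
      have hgap : n ≤ w.natAbs - n - R - R' := by omega
      have hexp : Real.exp (-(m * ((w.natAbs - n - R - R' : ℕ) : ℝ))) ≤ Real.exp (-(m * (n : ℝ))) := by
        refine Real.exp_le_exp.2 ?_
        have : (n : ℝ) ≤ ((w.natAbs - n - R - R' : ℕ) : ℝ) := by exact_mod_cast hgap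
        nlinarith
      have hεn := hε0 n
      rw [hΦ]
      dsimp only
      rw [if_neg hsmall, add_zero]
      calc |cov[f, g ∘ chainShift w; μ]|
          ≤ Real.sqrt (∫ σ, f σ ^ 2 ∂μ) * ε n +
              C * Real.exp (-(m * ((w.natAbs - n - R - R' : ℕ) : ℝ))) * Real.sqrt (∫ σ, f σ ^ 2 ∂μ) *
                (Real.sqrt (∫ σ, g σ ^ 2 ∂μ) + ε n) := key
        _ ≤ Mf * ε n + C * Real.exp (-(m * (n : ℝ))) * Mf * (Mg + ε n) := by
            gcongr
        _ = Mf * ε ((w.natAbs - (R + R')) / 2) +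
              C * Real.exp (-(m * (((w.natAbs - (R + R')) / 2 : ℕ) : ℝ))) * Mf *
                (Mg + ε ((w.natAbs - (R + R')) / 2)) := by rw [hn]

/-- **Summable clustering from mixing and quasi-locality** (non-uniform corollary): under the
hypotheses of `exists_summable_clustering_majorant` for one pair `(f, g)`, the truncated
correlations `w ↦ Cov_μ(f, g ∘ τ_w)` are absolutely summable over `ℤ`, i.e. integrable for the
counting measure (the clustering field of `FluctuationStructure` / `ZeroWavenumberData`). [folklore] -/
theorem integrable_count_covariance_comp_chainShift
    (hS : ∀ x : ℤ, MeasurePreserving (chainShift x) μ μ) {C m : ℝ} (hC : 0 ≤ C) (hm : 0 < m)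
    (hmix : ∀ (a : ℤ) (n : ℕ) (f g : ChainConfig → ℝ),
      DependsOn f {i : ℤ | i ≤ a} → DependsOn g {i : ℤ | a + n ≤ i} → Measurable f → Measurable g →
      MemLp f 2 μ → MemLp g 2 μ →
      |∫ σ, f σ * g σ ∂μ - (∫ σ, f σ ∂μ) * ∫ σ, g σ ∂μ| ≤
        C * Real.exp (-(m * n)) * (∫ σ, f σ ^ 2 ∂μ) ^ (1 / 2 : ℝ) * (∫ σ, g σ ^ 2 ∂μ) ^ (1 / 2 : ℝ))
    {R R' : ℕ} {ε : ℕ → ℝ} (hε0 : ∀ n, 0 ≤ ε n) (hε : Summable ε)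
    {f g : ChainConfig → ℝ} {gloc : ℕ → ChainConfig → ℝ}
    (hf : DependsOn f (Icc (-(R : ℤ)) R)) (hfm : Measurable f) (hf2 : MemLp f 2 μ) (hg2 : MemLp g 2 μ)
    (hdep : ∀ n, DependsOn (gloc n) (Icc (-(n : ℤ) - R') (n + R'))) (hglm : ∀ n, Measurable (gloc n))
    (hgl2 : ∀ n, MemLp (gloc n) 2 μ) (happ : ∀ n, Real.sqrt (∫ σ, (g σ - gloc n σ) ^ 2 ∂μ) ≤ ε n) :
    Integrable (fun w : ℤ => cov[f, g ∘ chainShift w; μ]) (Measure.count : Measure ℤ) := by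
  obtain ⟨F, hF, hbound⟩ := exists_summable_clustering_majorant hS hC hm hmix R R' hε0 hε
    (Real.sqrt_nonneg (∫ σ, f σ ^ 2 ∂μ)) (Real.sqrt_nonneg (∫ σ, g σ ^ 2 ∂μ))
  have hb := hbound f g gloc hf hfm hf2 le_rfl hg2 le_rfl hdep hglm hgl2 happ
  rw [integrable_count_iff]
  refine Summable.of_nonneg_of_le (fun w => norm_nonneg _) (fun w => ?_) hF
  rw [Real.norm_eq_abs]
  exact hb w

end Majorant

end Literature.MathematicalPhysics.KineticTheory.HeatConduction

end
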